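import Literature.NumberTheory.EllipticCurves.TowerSaturatedRepresentabilityProofs
import HarnessLib

/-!
# (Exact) for the saturated conditions of a tower, I: the class orthogonal to the saturated families is a `p^{k+1}`-th
# multiple of a representing family, up to a class orthogonal to ALL saturated families at ALL levels (generic tower algebra)

`Proofs` file (theorems only; no definition, no named fact, no instance, no `sorry`), in the currency of the tree's abstract
towers `Literature.NumberTheory.EllipticCurves.Tower.*` (`compatibleFamilies`, `saturatedFamilies red p C`, `levelCondition`,
`redIter`); sequel of x10b-p1-w2's `TowerSaturatedRepresentabilityProofs` (the representability theorem
`exists_mem_compatibleFamilies_forall_saturated_pairing_eq_functional`, brick (B5)).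

The exactness input (Exact) of the descent `Tower.levelCondition_mem_iff_forall_pairing_eq_zero` (x10b-p1-w8) reads, at a base
level `k` with exponent `n = p^{k+1}`: «a compatible family `η` of `Y` pairing to zero at level `k` with every saturated family of
`X` is `η = p^{k+1} η′ + ζ` with `ζ` in the saturated families of `Y`».  The rank-free proof of the cell memo
`HOME/p1/H4-EXACT-AT-P-PLAN-x10b-p1-g8.md` §1(e)–(f) (Howard 2004, H.4 for `F_𝔮` at `v ∣ p`) splits it in two:

* **(EXACT-REP), this file** — `Tower.exists_sub_pow_smul_forall_pairing_eq_zero`: there is a compatible `y″` with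
  `B_j (ξ_j, η_j − p^{k+1} y″_j) = 0` for EVERY saturated `ξ` and EVERY level `j`.  Proof: the functional
  `Ψ(ξ)_i := ι_i⁻¹ B_{k+1+i}(ξ_{k+1+i}, η_{k+1+i})` («`p^{-(k+1)} B_∞(ξ, η)`», through injective value maps
  `ι_i : Q_i ↪ Q_{k+1+i}` = `×p^{k+1}`, whose range contains the `p^{i+1}`-torsion) is well defined levelwise (by (E) «a saturated
  family vanishing at level `i` is a `p^{i+1}`-th multiple» and the projection formula), additive, homogeneous for the scalars and
  compatible; the representability theorem gives `y″` with `B_i(ξ_i, y″_i) = Ψ(ξ)_i`; the projection formula along the division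
  `×p^{k+1} : X_i ↪ X_{k+1+i}` turns this into `B_n(ξ_n, η_n) = p^{k+1} B_n(ξ_n, y″_n)` at the levels `n ≥ k+1`, and reduction
  (`redIter_pairing_apply_of_mem_compatibleFamilies`) gives all levels;
* (ANN-SAT), elsewhere — a compatible family orthogonal to all saturated families of `X` at all levels lies in the saturated
  families of `Y` (cores = strict cores; limit duality for the pair `(Fil, gr′)`).

All hypotheses are level identities supplied, for the curve's Eisenstein tower, by `ZpExtensionEisensteinDVRSettingH4*Proofs`
(hB, the value maps `×p^d` along `reduce`, the divisions `eisensteinTwistTorsionTransfer`, (Adj)/(Adj′), the readings (B5-INST)) and by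
x10b-p1-w7's `TowerLocalH1LiftExactProofs` ((E)).  Cell `pub/bsd-print-x9` (STUB A `hfin4` at `v ∣ p`, brick (B6-EXACT)).  Nothing
arithmetic is proved here; no summit statement is proved; BSD is not proved by any of this.

References: B. Howard, Compositio Math. 140 (2004), H.4 (arXiv:1202.6340 p. 7 L78–82), Lemma 3.1.1, Def. 3.2.6; J. S. Milne,
*Arithmetic Duality Theorems* (2006), I §0 Prop. 0.19, I Cor. 2.3 / Thm. 2.6; B. Mazur, K. Rubin, Mem. AMS 799 (2004), §1.3;
J.-P. Serre, *Galois Cohomology* (1997), I §2.2.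
-/

set_option autoImplicit false

noncomputable section

universe u v w

namespace Literature.NumberTheory.EllipticCurves

namespace Tower

variable {X : ℕ → Type u} [∀ j, AddCommGroup (X j)] (red : ∀ j, X (j + 1) →+ X j)
variable {Y : ℕ → Type v} [∀ j, AddCommGroup (Y j)] (red' : ∀ j, Y (j + 1) →+ Y j)
variable {Q : ℕ → Type w} [∀ j, AddCommGroup (Q j)] (redQ : ∀ j, Q (j + 1) →+ Q j)
variable (B : ∀ j, X j →+ Y j →+ Q j)

/-! ## §1 Reduction of the level pairings along compatible families -/

/-- **`red_Q^{(d)} (B_{j+d}(ξ_{j+d}, η_{j+d})) = B_j(ξ_j, η_j)`** for compatible families `ξ`, `η` and reduction-compatible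
pairings (iterate of hB). [cite: Howard2004HeegnerKolyvagin, §1.6 (arXiv p. 11, L33–38: the pairings of the tower are compatible)]
[cite: SerreGaloisCohomology1997, I §2.2] -/
theorem redIter_pairing_apply_of_mem_compatibleFamilies
    (hB : ∀ j (x : X (j + 1)) (y : Y (j + 1)), redQ j (B (j + 1) x y) = B j (red j x) (red' j y))
    {ξ : Π j, X j} (hξ : ξ ∈ compatibleFamilies red) {η : Π j, Y j} (hη : η ∈ compatibleFamilies red') (j : ℕ) :
    ∀ d : ℕ, redIter redQ j d (B (j + d) (ξ (j + d)) (η (j + d))) = B j (ξ j) (η j)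
  | 0 => rfl
  | d + 1 => by
    rw [redIter_succ]
    change redIter redQ j d (redQ (j + d) (B (j + d + 1) (ξ (j + d + 1)) (η (j + d + 1)))) = _
    rw [hB, (mem_compatibleFamilies_iff red ξ).1 hξ (j + d), (mem_compatibleFamilies_iff red' η).1 hη (j + d)]
    exact redIter_pairing_apply_of_mem_compatibleFamilies hB hξ hη j d

/-- A compatible family orthogonal to the saturated families at every level `≥ k + 1` is orthogonal to them at every level.
[cite: Howard2004HeegnerKolyvagin, §1.6 (arXiv p. 11, L33–38)] [cite: SerreGaloisCohomology1997, I §2.2] -/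
theorem forall_pairing_eq_zero_of_forall_le
    (hB : ∀ j (x : X (j + 1)) (y : Y (j + 1)), redQ j (B (j + 1) x y) = B j (red j x) (red' j y))
    (p : ℕ) (C : ∀ j, AddSubgroup (X j)) (k : ℕ) {ζ : Π j, Y j} (hζ : ζ ∈ compatibleFamilies red')
    (h : ∀ n, k + 1 ≤ n → ∀ ξ ∈ saturatedFamilies red p C, B n (ξ n) (ζ n) = 0) (j : ℕ) :
    ∀ ξ ∈ saturatedFamilies red p C, B j (ξ j) (ζ j) = 0 := fun ξ hξ ↦ by
  rw [← redIter_pairing_apply_of_mem_compatibleFamilies red red' redQ B hB hξ.1 hζ j (k + 1),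
    h (j + (k + 1)) (Nat.le_add_left _ _) ξ hξ, map_zero]

/-! ## §2 (EXACT-REP) -/

/-- **(EXACT-REP): a compatible family of `Y` orthogonal at level `k` to the saturated families of `X` is, up to a family
orthogonal to ALL saturated families at ALL levels, a `p^{k+1}`-th multiple of a compatible family.**  Hypotheses (all level
identities): reduction-compatible pairings (hB); scalars `S` acting on the `X_j`, `Q_j` with `B_j` `S`-linear in `x` and the
saturated families `S`-stable; levelwise readings `λ_j : Q_j → ℤ/n_j` with onto pairing adjoint (hsurj) and the Frobenius property
(hfrob) — the hypotheses of `exists_mem_compatibleFamilies_forall_saturated_pairing_eq_functional`; (E) «a compatible family of `X`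
vanishing at level `i` is a `p^{i+1}`-th multiple of a compatible family»; at the base level `k`: injective `S`-linear VALUE MAPS
`ι_i : Q_i → Q_{k+1+i}` compatible with the reductions and containing the `p^{i+1}`-torsion of `Q_{k+1+i}` in their range
(`×p^{k+1}` on `A_{m,•}`), the DIVISIONS `UP_i : X_k → X_{k+1+i}` (`p^{i+1} ξ_{k+1+i} = UP_i ξ_k` on compatible families) with the
projection formula in the weak form «`B_k(x, DOWN_i w) = 0 → B_{k+1+i}(UP_i x, w) = 0`» (`DOWN_i η_{k+1+i} = η_k`), and the divisions
`UP′_i : X_i → X_{k+1+i}` (`p^{k+1} ξ_{k+1+i} = UP′_i ξ_i`) with the projection formula `B_{k+1+i}(UP′_i x, w) = ι_i B_i(x, DOWN′_i w)`.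
Conclusion: for `η` compatible with `B_k(ξ_k, η_k) = 0` for all saturated `ξ`, there is a compatible `y″` with
`B_j(ξ_j, η_j − p^{k+1} • y″_j) = 0` for all saturated `ξ` and all `j`.
[cite: Howard2004HeegnerKolyvagin, H.4 and Lemma 3.1.1 / Def. 3.2.6 (arXiv p. 7 L78–82, pp. 15–16)]
[cite: MilneADT2006, Ch. I §0 Prop. 0.19 and Cor. 2.3 / Thm. 2.6] [cite: MazurRubinMemoirs2004, §1.3] -/
theorem exists_sub_pow_smul_forall_pairing_eq_zero [∀ j, Finite (X j)] [∀ j, Finite (Y j)] (p : ℕ)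
    (C : ∀ j, AddSubgroup (X j))
    (hB : ∀ j (x : X (j + 1)) (y : Y (j + 1)), redQ j (B (j + 1) x y) = B j (red j x) (red' j y))
    {S : Type*} [∀ j, SMul S (X j)] [∀ j, SMul S (Q j)]
    (n : ℕ → ℕ) [∀ j, NeZero (n j)] (hX : ∀ (j : ℕ) (x : X j), n j • x = 0)
    (lam : ∀ j, Q j →+ ZMod (n j))
    (hsurj : ∀ (j : ℕ) (χ : X j →+ ZMod (n j)), ∃ y : Y j, ∀ x : X j, lam j (B j x y) = χ x)
    (hfrob : ∀ (j : ℕ) (q q' : Q j), (∀ r : S, lam j (r • q) = lam j (r • q')) → q = q')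
    (hBlin : ∀ (j : ℕ) (r : S) (x : X j) (y : Y j), B j (r • x) y = r • B j x y)
    (hSat : ∀ (r : S), ∀ ξ ∈ saturatedFamilies red p C, (fun j ↦ r • ξ j) ∈ saturatedFamilies red p C)
    (hE : ∀ δ ∈ compatibleFamilies red, ∀ i : ℕ, δ i = 0 →
      ∃ ε ∈ compatibleFamilies red, ∀ j, δ j = p ^ (i + 1) • ε j)
    (k : ℕ)
    (ι : ∀ i : ℕ, Q i →+ Q (k + 1 + i)) (hιinj : ∀ i, Function.Injective (ι i))
    (hιS : ∀ (i : ℕ) (r : S) (q : Q i), ι i (r • q) = r • ι i q)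
    (hιred : ∀ (i : ℕ) (q : Q (i + 1)), redQ (k + 1 + i) (ι (i + 1) q) = ι i (redQ i q))
    (hιrange : ∀ (i : ℕ) (q : Q (k + 1 + i)), p ^ (i + 1) • q = 0 → q ∈ (ι i).range)
    (UP : ∀ i : ℕ, X k →+ X (k + 1 + i)) (DOWN : ∀ i : ℕ, Y (k + 1 + i) →+ Y k)
    (hUP : ∀ (i : ℕ), ∀ ξ ∈ compatibleFamilies red, p ^ (i + 1) • ξ (k + 1 + i) = UP i (ξ k))
    (hDOWN : ∀ (i : ℕ), ∀ η ∈ compatibleFamilies red', DOWN i (η (k + 1 + i)) = η k)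
    (hAdj0 : ∀ (i : ℕ) (x : X k) (w : Y (k + 1 + i)), B k x (DOWN i w) = 0 → B (k + 1 + i) (UP i x) w = 0)
    (UP' : ∀ i : ℕ, X i →+ X (k + 1 + i)) (DOWN' : ∀ i : ℕ, Y (k + 1 + i) →+ Y i)
    (hUP' : ∀ (i : ℕ), ∀ ξ ∈ compatibleFamilies red, p ^ (k + 1) • ξ (k + 1 + i) = UP' i (ξ i))
    (hDOWN' : ∀ (i : ℕ), ∀ η ∈ compatibleFamilies red', DOWN' i (η (k + 1 + i)) = η i)
    (hAdj' : ∀ (i : ℕ) (x : X i) (w : Y (k + 1 + i)), B (k + 1 + i) (UP' i x) w = ι i (B i x (DOWN' i w)))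
    (η : Π j, Y j) (hη : η ∈ compatibleFamilies red')
    (hη0 : ∀ ξ ∈ saturatedFamilies red p C, B k (ξ k) (η k) = 0) :
    ∃ y'' ∈ compatibleFamilies red', ∀ (j : ℕ), ∀ ξ ∈ saturatedFamilies red p C,
      B j (ξ j) (η j - p ^ (k + 1) • y'' j) = 0 := by
  classical
  -- (1) at the levels `k+1+i` the values `B(ξ, η)` are `p^{i+1}`-torsion, hence in the range of `ι_i`
  have hvan : ∀ (i : ℕ), ∀ ξ ∈ saturatedFamilies red p C,
      p ^ (i + 1) • B (k + 1 + i) (ξ (k + 1 + i)) (η (k + 1 + i)) = 0 := by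
    intro i ξ hξ
    rw [← AddMonoidHom.flip_apply (B (k + 1 + i)), ← map_nsmul, hUP i ξ hξ.1, AddMonoidHom.flip_apply]
    exact hAdj0 i (ξ k) _ (by rw [hDOWN i η hη]; exact hη0 ξ hξ)
  have hrange : ∀ (i : ℕ), ∀ ξ ∈ saturatedFamilies red p C,
      ∃ q₀ : Q i, ι i q₀ = B (k + 1 + i) (ξ (k + 1 + i)) (η (k + 1 + i)) := fun i ξ hξ ↦
    hιrange i _ (hvan i ξ hξ)
  -- (2) the functional `Ψ(ξ)_i := ι_i⁻¹ B_{k+1+i}(ξ, η)`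
  let Ψ : (Π j, X j) → (Π j, Q j) := fun ξ i ↦
    if h : ∃ q₀ : Q i, ι i q₀ = B (k + 1 + i) (ξ (k + 1 + i)) (η (k + 1 + i)) then h.choose else 0
  have hΨ : ∀ ξ ∈ saturatedFamilies red p C, ∀ i,
      ι i (Ψ ξ i) = B (k + 1 + i) (ξ (k + 1 + i)) (η (k + 1 + i)) := by
    intro ξ hξ i
    simp only [Ψ, dif_pos (hrange i ξ hξ)]
    exact (hrange i ξ hξ).choose_spec
  -- (3) well defined levelwise, by (E)
  have hwd : ∀ ξ ∈ saturatedFamilies red p C, ∀ ξ' ∈ saturatedFamilies red p C, ∀ i, ξ i = ξ' i → Ψ ξ i = Ψ ξ' i := by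
    intro ξ hξ ξ' hξ' i hi
    apply hιinj i
    rw [hΨ ξ hξ i, hΨ ξ' hξ' i, ← sub_eq_zero, ← AddMonoidHom.sub_apply, ← map_sub, ← Pi.sub_apply ξ ξ']
    have hδ : ξ - ξ' ∈ saturatedFamilies red p C := sub_mem hξ hξ'
    obtain ⟨ε, hε, hδε⟩ := hE (ξ - ξ') hδ.1 i (by rw [Pi.sub_apply, hi, sub_self])
    obtain ⟨a, ha⟩ := hδ.2
    have hεsat : ε ∈ saturatedFamilies red p C := by
      refine ⟨hε, a + (i + 1), fun j ↦ ?_⟩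
      rw [pow_add, mul_smul, ← hδε j]
      exact ha j
    rw [hδε (k + 1 + i), ← AddMonoidHom.flip_apply (B (k + 1 + i)), map_nsmul, AddMonoidHom.flip_apply]
    exact hvan i ε hεsat
  -- (4) additive
  have hadd : ∀ ξ ∈ saturatedFamilies red p C, ∀ ξ' ∈ saturatedFamilies red p C, Ψ (ξ + ξ') = Ψ ξ + Ψ ξ' := by
    intro ξ hξ ξ' hξ'
    funext i
    apply hιinj i
    rw [Pi.add_apply, map_add, hΨ ξ hξ i, hΨ ξ' hξ' i, hΨ (ξ + ξ') (add_mem hξ hξ') i, Pi.add_apply, map_add,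
      AddMonoidHom.add_apply]
  -- (5) homogeneous
  have hsmul : ∀ (i : ℕ) (r : S), ∀ ξ ∈ saturatedFamilies red p C, ∀ ξ' ∈ saturatedFamilies red p C,
      ξ' i = r • ξ i → Ψ ξ' i = r • Ψ ξ i := by
    intro i r ξ hξ ξ' hξ' hi
    have h1 : Ψ ξ' i = Ψ (fun j ↦ r • ξ j) i := hwd ξ' hξ' _ (hSat r ξ hξ) i hi
    rw [h1]
    apply hιinj i
    rw [hΨ _ (hSat r ξ hξ) i, hιS, hΨ ξ hξ i, hBlin]
  -- (6) compatible-valued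
  have hcompat : ∀ ξ ∈ saturatedFamilies red p C, Ψ ξ ∈ compatibleFamilies redQ := by
    intro ξ hξ
    refine (mem_compatibleFamilies_iff redQ _).2 fun i ↦ hιinj i ?_
    rw [← hιred, hΨ ξ hξ (i + 1), hΨ ξ hξ i]
    change redQ (k + 1 + i) (B (k + 1 + i + 1) (ξ (k + 1 + i + 1)) (η (k + 1 + i + 1))) = _
    rw [hB, (mem_compatibleFamilies_iff red ξ).1 hξ.1 (k + 1 + i), (mem_compatibleFamilies_iff red' η).1 hη (k + 1 + i)]
  -- (7) the saturated level conditions are `S`-stable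
  have hL : ∀ (j : ℕ) (r : S) (x : X j), x ∈ levelCondition red p C j → r • x ∈ levelCondition red p C j := by
    intro j r x hx
    obtain ⟨ξ, hξ, rfl⟩ := (mem_levelCondition_iff red p C j x).1 hx
    exact (mem_levelCondition_iff red p C j _).2 ⟨_, hSat r ξ hξ, rfl⟩
  -- (8) representability
  obtain ⟨y, hy, hyΨ⟩ := exists_mem_compatibleFamilies_forall_saturated_pairing_eq_functional red red' B p C redQ hB
    n hX lam hsurj (A := fun _ ↦ S) hfrob hBlin hL Ψ hwd hadd hsmul hcompat
  refine ⟨y, hy, ?_⟩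
  -- (9) the levels `n ≥ k + 1`
  have hζ : (fun j ↦ η j - p ^ (k + 1) • y j) ∈ compatibleFamilies red' := by
    refine (mem_compatibleFamilies_iff red' _).2 fun j ↦ ?_
    rw [map_sub, map_nsmul, (mem_compatibleFamilies_iff red' η).1 hη j, (mem_compatibleFamilies_iff red' y).1 hy j]
  have htop : ∀ m, k + 1 ≤ m → ∀ ξ ∈ saturatedFamilies red p C, B m (ξ m) (η m - p ^ (k + 1) • y m) = 0 := by
    intro m hm ξ hξ
    obtain ⟨i, rfl⟩ := Nat.exists_eq_add_of_le hm
    rw [map_sub, map_nsmul, sub_eq_zero, ← hΨ ξ hξ i, ← hyΨ ξ hξ i, ← hDOWN' i y hy, ← hAdj', ← hUP' i ξ hξ.1,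
      ← AddMonoidHom.flip_apply (B (k + 1 + i)), map_nsmul, AddMonoidHom.flip_apply]
  -- (10) all levels
  intro j ξ hξ
  exact forall_pairing_eq_zero_of_forall_le red red' redQ B hB p C k hζ htop j ξ hξ

end Tower

end Literature.NumberTheory.EllipticCurves

end
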